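import Summits.QuantumFields.QCD.Theorems.SpectralDefectExtinctionWindowExtinctionPeriodicIndexCarrierOf
import HarnessLib

/-!
# Stub `stub_carrierOfGap` of line `hermitian-flow-coarea` (reshape r6): the periodic index carrier from the
# transport statement and the IOS abelian index formula

Crux `Summit.QuantumFields.QCD.Theses.SpectralDefectExtinction.TipPricing` (item stmt-QuantumFields-8967), line
`hermitian-flow-coarea`, lead c4.  This file is the mechanical port of the sibling crux 8964's
`flux_periodicIndexCarrier_of` (`Theorems/SpectralDefectExtinctionWindowExtinctionPeriodicIndexCarrierOf.lean`,
namespace `Summit.QuantumFields.QCD.Cruxes.WindowExtinction.FreeVolumeHeavyWitness`) with its first hypothesis — the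
named fact `HJLLocality (fundamentalRep (Fin 3))` — replaced by the TRANSPORT statement it was only used to derive
(the conclusion of 8964's `flux_transport_of_HJL`: for every periodic four-torus, every `ε`-norm-admissible `SU(3)`
field and `0 < lo` with `30ε < lo²`, for all `δ ∈ [lo, 1]` the Hermitian Wilson–Dirac operator `Γ₅ D_W(U,−δ,1)` is
nonsingular and has the same number of negative characteristic roots as `Γ₅ D_W(U,−1,1)`), which is proved from the
HJL gap by the neighbouring stub `stub_transportOfGap` of the same line.

Construction (verbatim from the template).  Given a window `[lo, hi] ⊆ (0, 1/4]` put `c = lo²/60`, take an odd side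
`L = 2R+1 ≥ L₁` with `ν = ⌊cL²/(2π)⌋` flux quanta (`flux_arith`), the two-plane flux tensor `m₀₁ = ν`, `m₂₃ = sν`
(antisymmetrised), and the colour-diagonal `SU(3)` field `U₀ = diag(V_{[m]}, V_{[m]}⁻¹ = V_{[−m]}, 1 = V_{[0]})`
(`flux_exists_diagonalSU3`).  Then `n₋(Γ₅ D_W(U₀, −1, 1)) = (2L⁴ + ν²) + (2L⁴ + ν²) + 2L⁴`
(`flux_negCount_colourDiagonal` + the IOS fact at `m, −m, 0`; `s·Q₂(±m) = s²ν² = ν²`), the field is norm-admissible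
with `ε = c` (`flux_norm_plaquette_fluxSectorField_le`, `flux_normAdmissible_of_diagonal`: every plaquette is
`diag(e^{iθ}, e^{−iθ}, 1)`, `|θ| ≤ 2πν/L² ≤ c`), so the transport hypothesis (`30c < lo²`) carries the count unchanged
to every `δ ∈ [lo, 1] ⊇ [lo, hi]`, and `2ν² ≥ 96L³ + 1 + 12(L⁴ − (L−2)⁴)` by the choice of `L` (`flux_arith`).

Supports stmt-QuantumFields-8967.  No named facts beyond the two hypotheses, no `sorry`; axioms standard.

References: T. Igarashi, K. Okuyama, H. Suzuki, Nucl. Phys. B 644 (2002) 383 (Thm 3.1, (2.3), (3.4));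
M. Lüscher, Nucl. Phys. B 549 (1999) 295, §7.2; P. Hernández, K. Jansen, M. Lüscher, Nucl. Phys. B 552 (1999) 363,
(2.16).
-/

noncomputable section

namespace Summit.QuantumFields.QCD.Cruxes.TipPricing.HermitianFlowCoarea

open scoped BigOperators Topology Classical MeasureTheory Matrix ComplexConjugate
open Filter MeasureTheory Matrix
open Literature.MathematicalPhysics.QuantumLattice Literature.MathematicalPhysics.QuantumFieldTheory
  Literature.Probability.LatticeModels
open Summit.QuantumFields.QCD.Theorems.ExtinctionBuildsQCD.Negative
open Summit.QuantumFields.QCD.Cruxes.WindowExtinction.FreeVolumeHeavyWitness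

/-- **STUB T2 `stub_carrierOfGap`** (= `Transport → IOSFluxSectorIndex → PeriodicIndexCarrier` of the skeleton, fully
expanded).  Assume (i) the transport statement: for every periodic four-torus, every `ε`-norm-admissible `SU(3)` field
`U` and `0 < lo` with `30ε < lo²`, for all `δ ∈ [lo, 1]` the operator `Γ₅ D_W(U,−δ,1)` is nonsingular with the same
negative root count as `Γ₅ D_W(U,−1,1)`; and (ii) the named fact `IOSFluxSectorIndex` (Igarashi–Okuyama–Suzuki 2002).
Then for every window `0 < lo ≤ hi ≤ Q·lo`, `hi ≤ 1/4` there are an odd torus side `2R+1` and an `SU(3)` gauge field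
`U₀` on it with `n₋(Γ₅ D_W(U₀, −δ, 1)) ≥ 6(2R+1)⁴ + 96(2R+1)³ + 1 + 12((2R+1)⁴ − (2R−1)⁴)` for all `δ ∈ [lo, hi]`:
the colour-diagonal embedding of Lüscher's flux-sector field (see the module docstring).  Port of 8964's
`flux_periodicIndexCarrier_of` with `flux_transport_of_HJL … hHJL …` replaced by hypothesis (i). -/
theorem stub_carrierOfGap :
    (∀ (L : ℕ) [NeZero L] (U : GaugeConfig 4 L SU3) (ε lo : ℝ),
      IsNormAdmissible (fundamentalRep (Fin 3)) U ε → 0 < lo → 30 * ε < lo ^ 2 →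
      ∀ δ : ℝ, lo ≤ δ → δ ≤ 1 →
        (spinorLift gammaFive * wilsonDirac (fundamentalRep (Fin 3)) U (-δ) 1).det ≠ 0 ∧
        (spinorLift gammaFive * wilsonDirac (fundamentalRep (Fin 3)) U (-δ) 1).charpoly.roots.countP
            (fun z : ℂ => z.re < 0) =
          (spinorLift gammaFive * wilsonDirac (fundamentalRep (Fin 3)) U (-1) 1).charpoly.roots.countP
            (fun z : ℂ => z.re < 0)) →
    IOSFluxSectorIndex →
    ∀ (Q : ℕ) (lo hi : ℝ), 0 < lo → lo ≤ hi → hi ≤ Q * lo → hi ≤ 1 / 4 →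
      ∃ (R : ℕ) (U₀ : GaugeConfig 4 (2 * R + 1) SU3), ∀ δ : ℝ, lo ≤ δ → δ ≤ hi →
        6 * (2 * R + 1) ^ 4 + 96 * (2 * R + 1) ^ 3 + 1 + 12 * ((2 * R + 1) ^ 4 - (2 * R - 1) ^ 4) ≤
          negRootCount (spinorLift gammaFive * wilsonDirac (fundamentalRep (Fin 3)) U₀ (-δ) 1) := by
  intro hT hIOS Q lo hi hlo hlohi _hQ hhi
  obtain ⟨s, L₁, hs, hI⟩ := hIOS
  -- constants of the construction
  set c : ℝ := lo ^ 2 / 60 with hc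
  have hlo4 : lo ≤ 1 / 4 := hlohi.trans hhi
  have hc0 : 0 < c := by positivity
  have hlosq : lo ^ 2 ≤ (1 / 4) ^ 2 := pow_le_pow_left₀ hlo.le hlo4 2
  have hc50 : c ≤ 1 / 50 := by rw [hc]; linarith
  have hc1 : c ≤ 1 := by linarith
  obtain ⟨R, ν, hRL, hνc, hineq⟩ := flux_arith c hc0 hc1 L₁
  have hLpos : (0 : ℝ) < ((2 * R + 1 : ℕ) : ℝ) := by positivity
  -- the flux tensor and the fields
  set m : Fin 4 → Fin 4 → ℤ := fun a b : Fin 4 => if a = 0 ∧ b = 1 then (ν : ℤ) else if a = 1 ∧ b = 0 then -(ν : ℤ)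
      else if a = 2 ∧ b = 3 then s * ν else if a = 3 ∧ b = 2 then -(s * ν) else 0 with hmdef
  have hm : ∀ μ ν', m ν' μ = -m μ ν' := fun μ ν' => flux_tensor_anti s ν μ ν'
  have hnm : ∀ μ ν', (-m) ν' μ = -(-m) μ ν' := fun μ ν' => by simp only [Pi.neg_apply, hm μ ν']
  have hmabs : ∀ μ ν', |(m μ ν' : ℝ)| ≤ (ν : ℝ) := fun μ ν' => by
    have h := flux_tensor_abs_le s ν hs μ ν'
    rwa [Int.cast_natCast, Nat.abs_cast] at h
  have hnmabs : ∀ μ ν', |((-m) μ ν' : ℝ)| ≤ (ν : ℝ) := fun μ ν' => by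
    simp only [Pi.neg_apply, Int.cast_neg, abs_neg]; exact hmabs μ ν'
  -- admissibility bounds of the tensor entries: `2π|m| ≤ 2πν ≤ cL² ≤ L²/50`
  have hbnd : ∀ μ ν', 2 * Real.pi * |(m μ ν' : ℝ)| ≤ ((2 * R + 1 : ℕ) : ℝ) ^ 2 / 50 := fun μ ν' => by
    have h1 : 2 * Real.pi * |(m μ ν' : ℝ)| ≤ 2 * Real.pi * ν :=
      mul_le_mul_of_nonneg_left (hmabs μ ν') (by positivity)
    have h2 : c * ((2 * R + 1 : ℕ) : ℝ) ^ 2 ≤ ((2 * R + 1 : ℕ) : ℝ) ^ 2 / 50 := by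
      rw [le_div_iff₀ (by norm_num : (0 : ℝ) < 50)]; nlinarith [sq_nonneg (((2 * R + 1 : ℕ) : ℝ))]
    linarith
  have hnbnd : ∀ μ ν', 2 * Real.pi * |((-m) μ ν' : ℝ)| ≤ ((2 * R + 1 : ℕ) : ℝ) ^ 2 / 50 := fun μ ν' => by
    simp only [Pi.neg_apply, Int.cast_neg, abs_neg]; exact hbnd μ ν'
  set V : GaugeConfig 4 (2 * R + 1) Circle := fluxSectorField (2 * R + 1) m with hVdef
  obtain ⟨U, hU⟩ := flux_exists_diagonalSU3 (L := 2 * R + 1) V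
  refine ⟨R, U, fun δ hδlo hδhi => ?_⟩
  -- the three colour counts at the overlap point `m₀ = 1`
  have hcount0 := hI (2 * R + 1) hRL m hm hbnd
  have hcount1 := hI (2 * R + 1) hRL (-m) hnm hnbnd
  have hcount2 := hI (2 * R + 1) hRL 0 (fun _ _ => by simp) (fun _ _ => by simp; positivity)
  rw [fluxSectorField_neg, ← hVdef] at hcount1
  rw [fluxSectorField_zero] at hcount2
  rw [← hVdef] at hcount0
  have hQ0 : m 0 1 * m 2 3 - m 0 2 * m 1 3 + m 0 3 * m 1 2 = s * ν ^ 2 := flux_tensor_chern s ν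
  have hQ1 : (-m) 0 1 * (-m) 2 3 - (-m) 0 2 * (-m) 1 3 + (-m) 0 3 * (-m) 1 2 = s * ν ^ 2 := by
    simp only [Pi.neg_apply, neg_mul_neg]; exact hQ0
  have hss : s * s = 1 := by rcases hs with rfl | rfl <;> norm_num
  rw [hQ0] at hcount0
  rw [hQ1] at hcount1
  simp only [Pi.zero_apply, mul_zero, sub_zero, add_zero] at hcount2
  -- colour decomposition of the `SU(3)` count at `m₀ = 1`
  have hsum := flux_negCount_colourDiagonal (2 * R + 1) U ![V, V⁻¹, 1] hU (-1)
  rw [Fin.sum_univ_three] at hsum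
  simp only [Matrix.cons_val_zero, Matrix.cons_val_one, Matrix.head_cons, Matrix.cons_val_two,
    Matrix.tail_cons] at hsum
  -- norm-admissibility with `ε = c`
  have hplaq : ∀ (a : Fin 3) (x : TorusSite 4 (2 * R + 1)) (μ ν' : Fin 4),
      ‖(1 : ℂ) - ((plaquetteHolonomy (![V, V⁻¹, 1] a) x μ ν' : Circle) : ℂ)‖ ≤ c := by
    have hdiv : 2 * Real.pi * (ν : ℝ) / ((2 * R + 1 : ℕ) : ℝ) ^ 2 ≤ c := by
      rw [div_le_iff₀ (by positivity)]; exact hνc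
    intro a x μ ν'
    fin_cases a
    · simp only [Fin.zero_eta, Fin.isValue, Matrix.cons_val_zero]
      rw [hVdef]
      refine (flux_norm_plaquette_fluxSectorField_le m hm x μ ν').trans ?_
      refine le_trans ?_ hdiv
      gcongr
      exact hmabs μ ν'
    · simp only [Fin.mk_one, Fin.isValue, Matrix.cons_val_one]
      rw [hVdef, ← fluxSectorField_neg]
      refine (flux_norm_plaquette_fluxSectorField_le (-m) hnm x μ ν').trans ?_
      refine le_trans ?_ hdiv
      gcongr
      exact hnmabs μ ν'
    · simp only [Fin.reduceFinMk, Matrix.cons_val_two, Matrix.tail_cons, Matrix.head_cons]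
      have h1 : plaquetteHolonomy (1 : GaugeConfig 4 (2 * R + 1) Circle) x μ ν' = 1 := by
        simp [plaquetteHolonomy]
      rw [h1, Circle.coe_one, sub_self, norm_zero]
      exact hc0.le
  have hadm : IsNormAdmissible (fundamentalRep (Fin 3)) U c :=
    flux_normAdmissible_of_diagonal (2 * R + 1) U ![V, V⁻¹, 1] c hU hplaq
  -- transport of the count from `m₀ = 1` to the window by the transport hypothesis
  have h30 : 30 * c < lo ^ 2 := by rw [hc]; nlinarith [pow_pos hlo 2]
  have hδ1 : δ ≤ 1 := hδhi.trans (hhi.trans (by norm_num))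
  obtain ⟨_, htr⟩ := hT (2 * R + 1) U c lo hadm hlo h30 δ hδlo hδ1
  rw [negRootCount, htr, hsum]
  -- the arithmetic: each charged colour contributes `2L⁴ + ν²`, the neutral one `2L⁴`
  set c0 := (spinorLift gammaFive * wilsonDirac u1Rep V (-1) 1).charpoly.roots.countP fun z : ℂ => z.re < 0
    with hc0def
  set c1 := (spinorLift gammaFive * wilsonDirac u1Rep V⁻¹ (-1) 1).charpoly.roots.countP fun z : ℂ => z.re < 0
    with hc1def
  set c2 := (spinorLift gammaFive * wilsonDirac u1Rep (1 : GaugeConfig 4 (2 * R + 1) Circle) (-1) 1).charpoly.roots.countP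
      fun z : ℂ => z.re < 0 with hc2def
  have e0 : (c0 : ℤ) = 2 * ((2 * R + 1 : ℕ) : ℤ) ^ 4 + (ν : ℤ) ^ 2 := by
    rw [hcount0]; rw [← mul_assoc, hss, one_mul]
  have e1 : (c1 : ℤ) = 2 * ((2 * R + 1 : ℕ) : ℤ) ^ 4 + (ν : ℤ) ^ 2 := by
    rw [hcount1]; rw [← mul_assoc, hss, one_mul]
  have e2 : (c2 : ℤ) = 2 * ((2 * R + 1 : ℕ) : ℤ) ^ 4 := by rw [hcount2]
  have e0' : c0 = 2 * (2 * R + 1) ^ 4 + ν ^ 2 := by exact_mod_cast e0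
  have e1' : c1 = 2 * (2 * R + 1) ^ 4 + ν ^ 2 := by exact_mod_cast e1
  have e2' : c2 = 2 * (2 * R + 1) ^ 4 := by exact_mod_cast e2
  rw [e0', e1', e2']
  omega

end Summit.QuantumFields.QCD.Cruxes.TipPricing.HermitianFlowCoarea

end
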